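import Literature.AlgebraicGeometry.Frobenioids.ElementaryIsFrobenioid
import Literature.AlgebraicGeometry.Frobenioids.IsoSubanchorNotIsotropic
import Literature.AlgebraicGeometry.Frobenioids.PreFrobenioidDataOfFunctor
import Literature.AlgebraicGeometry.Frobenioids.BaseCategoryTheoreticityDefs
import Mathlib.CategoryTheory.SingleObj
import HarnessLib

/-!
# Frobenioids I, Prop. 1.5 / Def. 3.1 (i) for elementary Frobenioids: Frobenius-compact objects of
# `F_Φ` and the standard-type criterion — toolkit for the one-object Examples 3.6–3.9

Mochizuki, *The geometry of Frobenioids I: the general theory*, Kyushu J. Math. **62** (2008)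
293–400, kurims text p. 23 (Def. 1.2 (iv) "Frobenius-compact"), p. 27 (Prop. 1.5), p. 56 (Def. 3.1 (i))
[cite: MochizukiFrdI2008, Prop. 1.5 p.27] [cite: MochizukiFrdI2008, Def. 3.1 (i) p.56]. PROOF-ONLY toolkit
(no new notions) used by the companions of the example files of §3 (Examples 3.6–3.9, seat
abc-iut-L1-t8), all of which are elementary Frobenioids `F_Φ → F_{Φ^char}` over one-object bases:

* monoid lemmas: a saturation criterion for cancellative monoids (`b^n ∣ a^n ⇒ b ∣ a`) and
  `IsPreDivisorial.prod` (products of pre-divisorial monoids are pre-divisorial); `isMonoidOn_of_bijective`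
  (a functor `Φ : D → Mon` all of whose pull-back maps are bijective is a monoid on `D`, Def. 1.1 (ii));
* one-object bases: `B(M)` is connected; it is totally epimorphic when `M` is right-cancellative, e.g.
  `M = F_A` for an abelian group `A` (`ElemFrobenioidMonoid.isRightRegular_of_group`);
* **the conjugation formula in `F_Φ`** (`ElemFrobenioid.div_conj`): for `f ∈ Aut(A)` and `u ∈ O^×(A)`,
  `Div(f u f⁻¹) = Base(f⁻¹)^* Div(u)` — i.e. `Aut_{F_Φ}(A)` acts on `O^×(A) ≅ Φ(A)^±` (Prop. 1.5 (ii),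
  found's `unitsEquiv`) through `Aut_D(A_D)` via `Φ`; whence the reduction
  `ElemFrobenioid.isFrobeniusCompact_of` of Frobenius-compactness of `A ∈ Ob(F_Φ)` (Def. 1.2 (iv), in the
  operations form `PreFrobenioidData.IsFrobeniusCompact` of seat abc-iut-L1-t3) to two statements about the
  `Aut_D(A_D)`-module `Φ(A)^±`;
* **standard type for `F_Φ`** (`ElemFrobenioid.isOfStandardType_toChar_of`): by Prop. 1.5 (i) (found's
  `isFrobenioid_toChar`, `isIsotropic`, `isCoAngular`, `isFrobeniusNormalized`) clauses (a) and (c) of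
  Def. 3.1 (i) hold for every elementary Frobenioid, so `F_Φ` is of standard type as soon as (b), (d), (e) hold.
No statement of the paper is strengthened; nothing here is specific to the abc programme.
-/

namespace Literature.AlgebraicGeometry.Frobenioids

open CategoryTheory Opposite

universe w v v' u u'

/-! ### Monoid lemmas: saturation in fraction form, products, bijective pull-backs -/

section MonoidLemmas

variable {M : Type u} [CommMonoid M]

/-- Every element of `M^gp` is a fraction `a / b`. [cite: MochizukiFrdI2008, §0 p.11] -/
private theorem gp_exists_eq_div_efc (x : Algebra.GrothendieckGroup M) :
    ∃ a b : M, x = Algebra.GrothendieckGroup.of a / Algebra.GrothendieckGroup.of b := by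
  obtain ⟨⟨a, b⟩, h⟩ := (Localization.monoidOf (⊤ : Submonoid M)).surj x
  exact ⟨a, b, eq_div_iff_mul_eq'.mpr h⟩

/-- In a cancellative monoid, `M → M^gp` is injective. [cite: MochizukiFrdI2008, §0 p.11] -/
private theorem gp_of_injective_efc [IsCancelMul M] :
    Function.Injective (Algebra.GrothendieckGroup.of (M := M)) :=
  (isIntegral_iff_isCancelMul.mpr ‹_›).injective_of

/-- Saturation in fraction form, for a cancellative (= integral) monoid: if `M` is saturated then
`b^n ∣ a^n` (`n ≥ 1`) implies `b ∣ a` (FrdI §0 p. 11: `n · (a − b) ∈ M ⇒ a − b ∈ M`).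
[cite: MochizukiFrdI2008, §0 p.11] -/
theorem IsSaturated.dvd_of_pow_dvd_pow [IsCancelMul M] (h : IsSaturated M) {a b : M} {n : ℕ}
    (hn : 0 < n) (hab : b ^ n ∣ a ^ n) : b ∣ a := by
  obtain ⟨c, hc⟩ := hab
  have hx : (Algebra.GrothendieckGroup.of a / Algebra.GrothendieckGroup.of b) ^ n ∈
      Set.range (Algebra.GrothendieckGroup.of (M := M)) := by
    refine ⟨c, ?_⟩
    rw [div_pow, ← map_pow, ← map_pow, eq_div_iff_mul_eq', ← map_mul, hc, mul_comm]
  obtain ⟨m, hm⟩ := h.mem_range_of_pow_mem_range _ n hn hx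
  rw [eq_div_iff_mul_eq', ← map_mul] at hm
  exact ⟨m, by rw [mul_comm]; exact (gp_of_injective_efc hm).symm⟩

/-- Conversely, a cancellative monoid in which `b^n ∣ a^n` (`n ≥ 1`) implies `b ∣ a` is saturated.
[cite: MochizukiFrdI2008, §0 p.11] -/
theorem isSaturated_of_dvd_of_pow_dvd_pow [IsCancelMul M]
    (h : ∀ (a b : M) (n : ℕ), 0 < n → b ^ n ∣ a ^ n → b ∣ a) : IsSaturated M := by
  refine ⟨fun x n hn ⟨m₀, hx⟩ => ?_⟩
  obtain ⟨a, b, rfl⟩ := gp_exists_eq_div_efc x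
  rw [div_pow, ← map_pow, ← map_pow, eq_div_iff_mul_eq', ← map_mul] at hx
  have hx' : m₀ * b ^ n = a ^ n := gp_of_injective_efc hx
  obtain ⟨c, hc⟩ := h a b n hn ⟨m₀, by rw [← hx', mul_comm]⟩
  refine ⟨c, ?_⟩
  rw [eq_div_iff_mul_eq', ← map_mul, hc, mul_comm]

/-- **Products of pre-divisorial monoids are pre-divisorial** (Def. 1.1 (i): integral, saturated, of
characteristic type — each clause is checked componentwise). [cite: MochizukiFrdI2008, Def. 1.1 (i) p.19] -/
theorem IsPreDivisorial.prod {N : Type u'} [CommMonoid N] (hM : IsPreDivisorial M) (hN : IsPreDivisorial N) :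
    IsPreDivisorial (M × N) := by
  haveI : IsCancelMul M := isIntegral_iff_isCancelMul.mp hM.isIntegral
  haveI : IsCancelMul N := isIntegral_iff_isCancelMul.mp hN.isIntegral
  refine { isIntegral := isIntegral_iff_isCancelMul.mpr inferInstance, isSaturated := ?_, isOfCharType := ?_ }
  · refine isSaturated_of_dvd_of_pow_dvd_pow fun a b n hn ⟨c, hc⟩ => ?_
    have h1 : b.1 ^ n ∣ a.1 ^ n := ⟨c.1, by simpa using congrArg Prod.fst hc⟩
    have h2 : b.2 ^ n ∣ a.2 ^ n := ⟨c.2, by simpa using congrArg Prod.snd hc⟩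
    obtain ⟨d₁, hd₁⟩ := hM.isSaturated.dvd_of_pow_dvd_pow hn h1
    obtain ⟨d₂, hd₂⟩ := hN.isSaturated.dvd_of_pow_dvd_pow hn h2
    exact ⟨(d₁, d₂), Prod.ext hd₁ hd₂⟩
  · refine ⟨fun u a hua => ?_⟩
    have h1 : (Units.map (MonoidHom.fst M N) u : M) * a.1 = a.1 := congrArg Prod.fst hua
    have h2 : (Units.map (MonoidHom.snd M N) u : N) * a.2 = a.2 := congrArg Prod.snd hua
    have e1 := hM.isOfCharType.eq_one_of_mul_eq _ _ h1
    have e2 := hN.isOfCharType.eq_one_of_mul_eq _ _ h2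
    exact Units.ext (Prod.ext (by simpa using congrArg Units.val e1) (by simpa using congrArg Units.val e2))

/-- A bijective homomorphism induces an injection on `M^char = M/M^±` (units correspond under the
inverse isomorphism). [cite: MochizukiFrdI2008, §0 p.12] -/
theorem associatesMap_injective_of_bijective {N : Type u} [CommMonoid N] {φ : M →* N}
    (hφ : Function.Bijective φ) : Function.Injective (associatesMap φ) := by
  intro x y hxy
  obtain ⟨a, rfl⟩ := Associates.mk_surjective x
  obtain ⟨b, rfl⟩ := Associates.mk_surjective y
  rw [associatesMap_mk, associatesMap_mk, Associates.mk_eq_mk_iff_associated] at hxy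
  rw [Associates.mk_eq_mk_iff_associated]
  let e : M ≃* N := MulEquiv.ofBijective φ hφ
  have h := hxy.map e.symm.toMonoidHom
  have ha : e.symm.toMonoidHom (φ a) = a := e.symm_apply_apply a
  have hb : e.symm.toMonoidHom (φ b) = b := e.symm_apply_apply b
  rwa [ha, hb] at h

end MonoidLemmas

section MonoidOn

variable {D : Type u} [Category.{v} D]

/-- A functor `Φ : D → Mon` all of whose pull-back maps are bijective is a monoid on `D` (Def. 1.1 (ii):
(a) characteristic injectivity and (b) bijectivity along FSM-morphisms both follow).
[cite: MochizukiFrdI2008, Def. 1.1 (ii) p.19] -/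
theorem isMonoidOn_of_bijective {Φ : Dᵒᵖ ⥤ CommMonCat.{w}}
    (h : ∀ {A B : D} (f : B ⟶ A), Function.Bijective (pull Φ f)) : IsMonoidOn Φ where
  isCharInjective f := ⟨(h f).1, associatesMap_injective_of_bijective (h f)⟩
  bijective_of_isFSM f _ := h f

end MonoidOn

/-! ### One-object bases -/

section OneObjectBases

/-- A one-object category is connected. [cite: MochizukiFrdI2008, §0 p.14] -/
theorem isGraphConnected_singleObj (M : Type u) [Monoid M] : IsGraphConnected (SingleObj M) :=
  ⟨⟨SingleObj.star M⟩, fun X Y => by cases X; cases Y; exact Zigzag.refl _⟩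

/-- A one-object category `B(M)` is totally epimorphic when `M` is right-cancellative (an arrow `f` is epi iff
`g f = g' f ⇒ g = g'`). [cite: MochizukiFrdI2008, §0 p.14] -/
theorem isTotallyEpimorphic_singleObj_of_isRightRegular (M : Type u) [Monoid M]
    (h : ∀ m : M, IsRightRegular m) : IsTotallyEpimorphic (SingleObj M) :=
  ⟨fun f => ⟨fun g g' e => h _ (by rwa [SingleObj.comp_as_mul, SingleObj.comp_as_mul] at e)⟩⟩

/-- In `F_A` for an abelian group `A` every element is right-cancellative:
`(b, m)(a, n) = (b', m')(a, n)` forces `m = m'` and then `b = b'`. [cite: MochizukiFrdI2008, Def. 1.1 (iii) p.20] -/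
theorem ElemFrobenioidMonoid.isRightRegular_of_group {A : Type u} [CommGroup A] (x : ElemFrobenioidMonoid A) :
    IsRightRegular x := by
  intro g g' e
  have hd : g.degFr = g'.degFr := by
    have := congrArg ElemFrobenioidMonoid.degFr e
    simp only [ElemFrobenioidMonoid.mul_degFr] at this
    exact mul_right_cancel this
  have hv : g.div = g'.div := by
    have := congrArg ElemFrobenioidMonoid.div e
    simp only [ElemFrobenioidMonoid.mul_div] at this
    rw [hd] at this
    exact mul_right_cancel this
  exact ElemFrobenioidMonoid.ext hv hd

/-- Hence the one-object category of `F_A`, `A` an abelian group, is totally epimorphic.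
[cite: MochizukiFrdI2008, §0 p.14] -/
theorem isTotallyEpimorphic_singleObj_elemFrobenioidMonoid (A : Type u) [CommGroup A] :
    IsTotallyEpimorphic (SingleObj (ElemFrobenioidMonoid A)) :=
  isTotallyEpimorphic_singleObj_of_isRightRegular _ ElemFrobenioidMonoid.isRightRegular_of_group

end OneObjectBases

/-! ### The conjugation formula in `F_Φ` and Frobenius-compact objects -/

namespace ElemFrobenioid

variable {D : Type u} [Category.{v} D] {Φ : Dᵒᵖ ⥤ CommMonCat.{w}}

/-- An isomorphism of `F_Φ` is linear. [cite: MochizukiFrdI2008, Def. 1.2 (i) p.21] -/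
theorem degFr_hom_eq_one {A B : ElemFrobenioid Φ} (f : A ≅ B) : degFr f.hom = 1 :=
  PreFrobenioid.isLinear_of_isIso (toChar Φ) f.hom

/-- `Base(f⁻¹)^* Div(f) · Div(f⁻¹) = 0` for an isomorphism `f` of `F_Φ` (from `f⁻¹ ∘ … `; here `f.inv ≫ f.hom = id`).
[cite: MochizukiFrdI2008, Def. 1.1 (iii) p.20] -/
theorem pull_div_hom_mul_div_inv {A B : ElemFrobenioid Φ} (f : A ≅ B) :
    pull Φ (Base f.inv) (Div f.hom) * Div f.inv = 1 := by
  have h : Div (f.inv ≫ f.hom) = 1 := by rw [f.inv_hom_id]; rfl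
  rwa [div_comp, degFr_hom_eq_one, PNat.one_coe, pow_one] at h

/-- A conjugate `f u f⁻¹` of a unit `u ∈ O^×(A)` of `F_Φ` by `f ∈ Aut(A)` is a unit.
[cite: MochizukiFrdI2008, Def. 1.2 (iv) p.23] -/
theorem conj_mem_unitsSubgroup {A : ElemFrobenioid Φ} (f u : Aut A)
    (hu : u ∈ PreFrobenioid.unitsSubgroup (toChar Φ) A) :
    f * u * f⁻¹ ∈ PreFrobenioid.unitsSubgroup (toChar Φ) A := by
  have hub : Base u.hom = 𝟙 A.base := hu.1
  have hud : degFr u.hom = 1 := hu.2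
  refine ⟨?_, ?_⟩
  · change Base (f.inv ≫ u.hom ≫ f.hom) = 𝟙 A.base
    rw [base_comp, base_comp, hub, Category.id_comp, ← base_comp, f.inv_hom_id, base_id]
  · have hfi : degFr f.inv = 1 := degFr_hom_eq_one f.symm
    change degFr (f.inv ≫ u.hom ≫ f.hom) = 1
    rw [degFr_comp, degFr_comp, hud, degFr_hom_eq_one f, hfi, one_mul, one_mul]

/-- **The conjugation formula in `F_Φ`**: for `f ∈ Aut_{F_Φ}(A)` and a unit `u = (id, c, 1) ∈ O^×(A)`,
`Div(f u f⁻¹) = Base(f⁻¹)^*(c)` — `Aut(A)` acts on `O^×(A) ≅ Φ(A)^±` through `Aut_D(A_D)` via `Φ`.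
[cite: MochizukiFrdI2008, Def. 1.2 (iv) p.23] -/
theorem div_conj {A : ElemFrobenioid Φ} (f u : Aut A) (hu : u ∈ PreFrobenioid.unitsSubgroup (toChar Φ) A) :
    Div (f * u * f⁻¹).hom = pull Φ (Base f.inv) (Div u.hom) := by
  have hub : Base u.hom = 𝟙 A.base := hu.1
  have hud : degFr u.hom = 1 := hu.2
  change Div (f.inv ≫ u.hom ≫ f.hom) = _
  rw [div_comp, div_comp, degFr_comp, hub, pull_id, hud, degFr_hom_eq_one f, PNat.one_coe, pow_one,
    one_mul, PNat.one_coe, pow_one, map_mul, mul_right_comm, pull_div_hom_mul_div_inv, one_mul]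

/-- The conjugation formula through found's `unitsEquiv : O^×(A) ⥲ Φ(A)^±` (Prop. 1.5 (ii)): conjugation by
`f` becomes `Units.map (Base(f⁻¹)^*)`. [cite: MochizukiFrdI2008, Prop. 1.5 p.27] -/
theorem unitsEquiv_conj {A : ElemFrobenioid Φ} (f : Aut A) (u : PreFrobenioid.unitsSubgroup (toChar Φ) A) :
    unitsEquiv A ⟨f * u.1 * f⁻¹, conj_mem_unitsSubgroup f u.1 u.2⟩ =
      Units.map (pull Φ (Base f.inv)) (unitsEquiv A u) :=
  Units.ext (div_conj f u.1 u.2)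

/-- **Frobenius-compactness in `F_Φ`, reduced to `Φ(A)^±`** (Def. 1.2 (iv) p. 23 through the adapter
`PreFrobenioidData.ofFunctor` of seat abc-iut-L1-t3): `A ∈ Ob(F_Φ)` is Frobenius-compact provided
(1) `Φ(A)^±` has an element of infinite order and (2) for every automorphism `β` of `A_D` in `D`: if `β^*`
acts on `(Φ(A)^±)^pf` as multiplication by some `p/q ∈ ℚ_{>0}` then it acts trivially on `(Φ(A)^±)^pf`
(commutativity of `O^×(A) ≅ Φ(A)^±` being automatic). [cite: MochizukiFrdI2008, Def. 1.2 (iv) p.23] -/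
theorem isFrobeniusCompact_of (A : ElemFrobenioid Φ)
    (h2 : ∃ c : (Φ.obj (op A.base))ˣ, ∀ N : ℕ, 0 < N → c ^ N ≠ 1)
    (h3 : ∀ (β : A.base ⟶ A.base) (p q : ℕ+), IsIso β →
      (∀ c : (Φ.obj (op A.base))ˣ, ∃ N : ℕ, 0 < N ∧ ((Units.map (pull Φ β) c) ^ (q : ℕ)) ^ N = (c ^ (p : ℕ)) ^ N) →
        ∀ c : (Φ.obj (op A.base))ˣ, ∃ N : ℕ, 0 < N ∧ (Units.map (pull Φ β) c) ^ N = c ^ N) :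
    (PreFrobenioidData.ofFunctor (charFunctor Φ) (toChar Φ)).IsFrobeniusCompact A := by
  let S := PreFrobenioid.unitsSubgroup (toChar Φ) A
  let e : S ≃* (Φ.obj (op A.base))ˣ := unitsEquiv A
  change (∀ u ∈ S, ∀ u' ∈ S, u * u' = u' * u) ∧ (∃ u ∈ S, ∀ N : ℕ, 0 < N → u ^ N ≠ 1) ∧
    ∀ (f : Aut A) (p q : ℕ+), (∀ u ∈ S, ∃ N : ℕ, 0 < N ∧ ((f * u * f⁻¹) ^ (q : ℕ)) ^ N = (u ^ (p : ℕ)) ^ N) →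
      ∀ u ∈ S, ∃ N : ℕ, 0 < N ∧ (f * u * f⁻¹) ^ N = u ^ N
  refine ⟨fun u hu u' hu' => ?_, ?_, fun f p q hyp u hu => ?_⟩
  · -- (1) `O^×(A) ≅ Φ(A)^±` is commutative
    have h : e (⟨u, hu⟩ * ⟨u', hu'⟩) = e (⟨u', hu'⟩ * ⟨u, hu⟩) := by rw [map_mul, map_mul, mul_comm]
    exact congrArg (fun x : S => (x : Aut A)) (e.injective h)
  · -- (2) an element of infinite order
    obtain ⟨c, hc⟩ := h2
    refine ⟨(e.symm c : S), (e.symm c).2, fun N hN hN1 => hc N hN ?_⟩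
    have h1 : (e.symm c) ^ N = 1 := Subtype.ext hN1
    have h2' := congrArg e h1
    rwa [map_pow, MulEquiv.apply_symm_apply, map_one] at h2'
  · -- (3) positive rational powers act trivially
    have hβ : IsIso (Base f.inv) := by
      change IsIso (PreFrobenioid.Base (toChar Φ) f.symm.hom)
      exact PreFrobenioid.isBaseIso_of_isIso (toChar Φ) f.symm.hom
    have key : ∀ (v : S) (k : ℕ),
        e (⟨f * v.1 * f⁻¹, conj_mem_unitsSubgroup f v.1 v.2⟩ ^ k) = (Units.map (pull Φ (Base f.inv)) (e v)) ^ k := by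
      intro v k
      rw [map_pow, unitsEquiv_conj]
    have hyp' : ∀ c : (Φ.obj (op A.base))ˣ, ∃ N : ℕ, 0 < N ∧
        ((Units.map (pull Φ (Base f.inv)) c) ^ (q : ℕ)) ^ N = (c ^ (p : ℕ)) ^ N := by
      intro c
      obtain ⟨N, hN, hc⟩ := hyp (e.symm c : S) (e.symm c).2
      refine ⟨N, hN, ?_⟩
      have h1 : (⟨f * (e.symm c : S).1 * f⁻¹, conj_mem_unitsSubgroup f _ (e.symm c).2⟩ ^ (q : ℕ)) ^ N =
          ((e.symm c) ^ (p : ℕ)) ^ N := Subtype.ext hc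
      have h2' := congrArg e h1
      rw [← pow_mul, ← pow_mul, key, map_pow, MulEquiv.apply_symm_apply, pow_mul, pow_mul] at h2'
      exact h2'
    obtain ⟨N, hN, hc⟩ := h3 (Base f.inv) p q hβ hyp' (e ⟨u, hu⟩)
    refine ⟨N, hN, ?_⟩
    have h1 : e (⟨f * u * f⁻¹, conj_mem_unitsSubgroup f u hu⟩ ^ N) = e (⟨u, hu⟩ ^ N) := by
      rw [key ⟨u, hu⟩ N, map_pow, hc]
    exact congrArg (fun x : S => (x : Aut A)) (e.injective h1)

/-! ### Standard type for elementary Frobenioids -/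

/-- Every object of `F_Φ` is Frobenius-isotropic: the identity is of Frobenius type (every morphism of `F_Φ`
is co-angular) and the object itself is isotropic (Prop. 1.5 (i)). [cite: MochizukiFrdI2008, Prop. 1.5 p.27] -/
theorem isFrobeniusIsotropic (A : ElemFrobenioid Φ) :
    (PreFrobenioidData.ofFunctor (charFunctor Φ) (toChar Φ)).IsFrobeniusIsotropic A := by
  refine ⟨A, 𝟙 A, ?_, (PreFrobenioidData.ofFunctor_isIsotropic (toChar Φ) A).mpr (isIsotropic A)⟩
  rw [PreFrobenioidData.ofFunctor_isFrobeniusType]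
  exact ⟨⟨isCoAngular _, isIsometry_id A⟩, show IsIso (𝟙 A.base) from inferInstance⟩

/-- **Standard type for `F_Φ`** (Def. 3.1 (i) with Prop. 1.5 (i)): for a pre-divisorial monoid `Φ` on a
connected, totally epimorphic category `D`, the Frobenioid `F_Φ → F_{Φ^char}` is of standard type as soon as
(b) [if it is of group-like type, some object is Frobenius-compact], (d) `D` is of FSMFF-type and (e) `Φ^char`
is non-dilating — clauses (a) (quasi-isotropic, via Rem. 3.1.1, and Frobenius-isotropic) and (c)
(Frobenius-normalized) being automatic for elementary Frobenioids. [cite: MochizukiFrdI2008, Def. 3.1 (i) p.56] -/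
theorem isOfStandardType_toChar_of (hΦ : IsMonoidOn Φ) (hpre : Objectwise (fun M _ => IsPreDivisorial M) Φ)
    (hDc : IsGraphConnected D) (hDe : IsTotallyEpimorphic D)
    (hb : PreFrobenioid.IsOfType (PreFrobenioid.IsGroupLikeObj (toChar Φ)) →
      ∃ A : ElemFrobenioid Φ, (PreFrobenioidData.ofFunctor (charFunctor Φ) (toChar Φ)).IsFrobeniusCompact A)
    (hd : IsOfFSMFFType D)
    (he : (PreFrobenioidData.ofFunctor (charFunctor Φ) (toChar Φ)).IsNonDilatingOn) :
    (PreFrobenioidData.ofFunctor (charFunctor Φ) (toChar Φ)).IsOfStandardType := by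
  have hiso : (PreFrobenioidData.ofFunctor (charFunctor Φ) (toChar Φ)).IsOfIsotropicType :=
    ⟨fun A => (PreFrobenioidData.ofFunctor_isIsotropic (toChar Φ) A).mpr (isIsotropic A)⟩
  exact
    { quasiIsotropic := isOfQuasiIsotropicType_of_isOfIsotropicType (charFunctor Φ) (toChar Φ)
        (isFrobenioid_toChar hΦ hpre hDc hDe) hiso
      frobeniusIsotropic := ⟨isFrobeniusIsotropic⟩
      frobeniusCompact_of_groupLike := fun hg => by
        obtain ⟨A, hA⟩ := hb fun A => (PreFrobenioidData.ofFunctor_isGroupLikeObj (toChar Φ) A).mp (hg.obj A)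
        exact ⟨A, hiso.obj A, hA⟩
      frobeniusNormalized := ⟨fun A => isFrobeniusNormalized A⟩
      fsmff := hd
      nonDilating := he }

end ElemFrobenioid

end Literature.AlgebraicGeometry.Frobenioids
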